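import Summits.AtomisticToContinuum.Crystallization.Theorems.ExcessDecayLiouvilleSiteGeometry
import Summits.AtomisticToContinuum.Crystallization.Theorems.ExcessDecayLiouvilleForceTail

/-!
# Route `ExcessDecayLiouville`: the reference force of a perfect affine two-lattice

For an admissible datum `(t, A)` with hcp-like inner displacement, the Lennard-Jones force exerted on a
site `s` of the perfect two-lattice `S = Sites₀ t A` by all other sites,
`F(s) = Σ'_{q ∈ S, q ≠ s} (V′(|s−q|)/|s−q|)·(s−q)`,
is an absolutely convergent lattice sum (`summable_refForce`, from the force tail over the
`23/25`-separated site set) and is invariant under the lattice translations `s ↦ s + A λ`, `λ ∈ Λ₀`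
(`refForce_add`), hence constant on each of the two sublattices.  This is step (a) of the linearisation
in the excess-decay argument for item `ExcessDecay` (stmt-AtomisticToContinuum-9334): the displacement
field of a near-lattice equilibrium solves the force-constant system with the constant sublattice forces
`F(t 0)`, `F(t 1)` as right-hand side (absorbed by the free sublattice translations).
Moreover the two sublattice forces are OPPOSITE, `F(t 0) + F(t 1) = 0`
(`refForce_zero_add_refForce_one`: same-sublattice contributions vanish by inversion symmetry, the two
cross contributions are exchanged by `z ↦ −z`) — a uniform strain produces only an optical net force.
Consequently the perfect two-lattice is itself in force balance iff `F(t 0) = 0` (`sites_equil_iff`).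
Also: closure of the site set under `± A λ`, oddness of the pair force, the decomposition of the
punctured site set into the two sublattices.  All `[folklore]`; nothing here closes an item.
-/

noncomputable section

namespace Summit.AtomisticToContinuum.Crystallization.Theorems.ExcessDecayLiouville

open scoped BigOperators Topology
open Literature.MathematicalPhysics.StatisticalMechanics
open Summit.AtomisticToContinuum.Crystallization.Theorems.PhononStabilityNegative
open Summit.AtomisticToContinuum.Crystallization.Theorems

section

variable {t : Fin 2 → (EuclideanSpace ℝ (Fin 3))} {A : (EuclideanSpace ℝ (Fin 3)) →L[ℝ] (EuclideanSpace ℝ (Fin 3))}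

/-- The site set is closed under the lattice translations `+ A λ`, `λ ∈ Λ₀`. [folklore] -/
theorem add_mem_sites₀ {s l : (EuclideanSpace ℝ (Fin 3))} (hs : s ∈ Sites₀ t A) (hl : l ∈ Λ₀) : s + A l ∈ Sites₀ t A := by
  obtain ⟨m, z, hz, rfl⟩ := hs
  exact ⟨m, z + l, hcpLiouvilleLam_add_mem hz hl, by rw [map_add]; abel⟩

/-- The site set is closed under the lattice translations `− A λ`, `λ ∈ Λ₀`. [folklore] -/
theorem sub_mem_sites₀ {s l : (EuclideanSpace ℝ (Fin 3))} (hs : s ∈ Sites₀ t A) (hl : l ∈ Λ₀) : s - A l ∈ Sites₀ t A := by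
  obtain ⟨m, z, hz, rfl⟩ := hs
  exact ⟨m, z - l, hcpLiouvilleLam_sub_mem hz hl, by rw [map_sub]; abel⟩

/-- The pair force `(V′(|v|)/|v|)·v` is odd in the bond vector. [folklore] -/
theorem ljForce_neg (v : (EuclideanSpace ℝ (Fin 3))) :
    (deriv lennardJones ‖-v‖ / ‖-v‖) • (-v) = -((deriv lennardJones ‖v‖ / ‖v‖) • v) := by
  rw [norm_neg, smul_neg]

/-- **The reference force is an absolutely convergent lattice sum**: for a site `s` and any set `U` of
other sites, the norms of the forces `(V′(|s−q|)/|s−q|)·(s−q)`, `q ∈ U`, are summable (sites are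
`23/25`-separated, and `|V′(d)| ≤ d⁻¹³ + d⁻⁷`). [folklore] -/
theorem summable_norm_refForce_on (hA : Adm₀ A) (hI : Inner₀ t A) {s : (EuclideanSpace ℝ (Fin 3))} (hs : s ∈ Sites₀ t A)
    {U : Set (EuclideanSpace ℝ (Fin 3))} (hU : U ⊆ {q : (EuclideanSpace ℝ (Fin 3)) | q ∈ Sites₀ t A ∧ q ≠ s}) :
    Summable (fun q : U => ‖(deriv lennardJones (dist s q) / dist s q) • (s - (q : (EuclideanSpace ℝ (Fin 3))))‖) := by
  have hsep : ∀ a ∈ U, ∀ b ∈ U, a ≠ b → (23 / 25 : ℝ) ≤ dist a b :=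
    fun a ha b hb hab => dist_sites_ge hA hI (hU ha).1 (hU hb).1 hab
  have hfar : ∀ q ∈ U, (23 / 25 : ℝ) ≤ dist q s := fun q hq => dist_sites_ge hA hI (hU hq).1 hs (hU hq).2
  let e : U ≃ {q : (EuclideanSpace ℝ (Fin 3)) // q ∈ U ∧ (23 / 25 : ℝ) ≤ dist q s} :=
    { toFun := fun q => ⟨q, q.2, hfar q q.2⟩
      invFun := fun q => ⟨q, q.2.1⟩
      left_inv := fun q => by ext; rfl
      right_inv := fun q => by ext; rfl }
  have h13 := summable_inv_pow_of_separated (X := U) s (k := 10) (by norm_num)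
    (by norm_num : (0 : ℝ) < 23 / 25) le_rfl hsep
  have h7 := summable_inv_pow_of_separated (X := U) s (k := 4) (by norm_num)
    (by norm_num : (0 : ℝ) < 23 / 25) le_rfl hsep
  have hsum : Summable (fun q : {q : (EuclideanSpace ℝ (Fin 3)) // q ∈ U ∧ (23 / 25 : ℝ) ≤ dist q s} =>
      (dist (q : (EuclideanSpace ℝ (Fin 3))) s)⁻¹ ^ (10 + 3) + (dist (q : (EuclideanSpace ℝ (Fin 3))) s)⁻¹ ^ (4 + 3)) := h13.add h7
  have hsum' := (e.summable_iff.2 hsum : Summable fun q => _)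
  refine Summable.of_nonneg_of_le (fun _ => norm_nonneg _) (fun q => ?_) hsum'
  have hne : s ≠ (q : (EuclideanSpace ℝ (Fin 3))) := fun h => (hU q.2).2 h.symm
  have hd : 0 < dist s q := dist_pos.2 hne
  show ‖(deriv lennardJones (dist s q) / dist s q) • (s - (q : (EuclideanSpace ℝ (Fin 3))))‖ ≤
    (dist ((e q : {q : (EuclideanSpace ℝ (Fin 3)) // q ∈ U ∧ (23 / 25 : ℝ) ≤ dist q s}) : (EuclideanSpace ℝ (Fin 3))) s)⁻¹ ^ (10 + 3) +
      (dist ((e q : {q : (EuclideanSpace ℝ (Fin 3)) // q ∈ U ∧ (23 / 25 : ℝ) ≤ dist q s}) : (EuclideanSpace ℝ (Fin 3))) s)⁻¹ ^ (4 + 3)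
  have hcoe : ((e q : {q : (EuclideanSpace ℝ (Fin 3)) // q ∈ U ∧ (23 / 25 : ℝ) ≤ dist q s}) : (EuclideanSpace ℝ (Fin 3))) = q := rfl
  rw [hcoe, norm_ljForce_eq hne, dist_comm (q : (EuclideanSpace ℝ (Fin 3))) s]
  exact abs_deriv_lennardJones_le hd

/-- The reference force family is summable on any set of other sites. [folklore] -/
theorem summable_refForce_on (hA : Adm₀ A) (hI : Inner₀ t A) {s : (EuclideanSpace ℝ (Fin 3))} (hs : s ∈ Sites₀ t A)
    {U : Set (EuclideanSpace ℝ (Fin 3))} (hU : U ⊆ {q : (EuclideanSpace ℝ (Fin 3)) | q ∈ Sites₀ t A ∧ q ≠ s}) :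
    Summable (fun q : U => (deriv lennardJones (dist s q) / dist s q) • (s - (q : (EuclideanSpace ℝ (Fin 3))))) :=
  (summable_norm_refForce_on hA hI hs hU).of_norm

/-- The norms of the full reference force family are summable. [folklore] -/
theorem summable_norm_refForce (hA : Adm₀ A) (hI : Inner₀ t A) {s : (EuclideanSpace ℝ (Fin 3))} (hs : s ∈ Sites₀ t A) :
    Summable (fun q : {q : (EuclideanSpace ℝ (Fin 3)) // q ∈ Sites₀ t A ∧ q ≠ s} =>
      ‖(deriv lennardJones (dist s q) / dist s q) • (s - (q : (EuclideanSpace ℝ (Fin 3))))‖) :=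
  summable_norm_refForce_on hA hI hs (U := {q : (EuclideanSpace ℝ (Fin 3)) | q ∈ Sites₀ t A ∧ q ≠ s}) subset_rfl

/-- The full reference force family is summable. [folklore] -/
theorem summable_refForce (hA : Adm₀ A) (hI : Inner₀ t A) {s : (EuclideanSpace ℝ (Fin 3))} (hs : s ∈ Sites₀ t A) :
    Summable (fun q : {q : (EuclideanSpace ℝ (Fin 3)) // q ∈ Sites₀ t A ∧ q ≠ s} =>
      (deriv lennardJones (dist s q) / dist s q) • (s - (q : (EuclideanSpace ℝ (Fin 3))))) :=
  (summable_norm_refForce hA hI hs).of_norm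

/-- **Translation invariance of the reference force**: `F(s + Aλ) = F(s)` for `λ ∈ Λ₀` (reindex the
lattice sum by `q ↦ q + Aλ`). [folklore] -/
theorem refForce_add (s : (EuclideanSpace ℝ (Fin 3))) {l : (EuclideanSpace ℝ (Fin 3))} (hl : l ∈ Λ₀) :
    (∑' q : {q : (EuclideanSpace ℝ (Fin 3)) // q ∈ Sites₀ t A ∧ q ≠ s + A l},
      (deriv lennardJones (dist (s + A l) q) / dist (s + A l) q) • (s + A l - (q : (EuclideanSpace ℝ (Fin 3))))) =
    ∑' q : {q : (EuclideanSpace ℝ (Fin 3)) // q ∈ Sites₀ t A ∧ q ≠ s},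
      (deriv lennardJones (dist s q) / dist s q) • (s - (q : (EuclideanSpace ℝ (Fin 3)))) := by
  let e : {q : (EuclideanSpace ℝ (Fin 3)) // q ∈ Sites₀ t A ∧ q ≠ s} ≃ {q : (EuclideanSpace ℝ (Fin 3)) // q ∈ Sites₀ t A ∧ q ≠ s + A l} :=
    { toFun := fun q => ⟨q + A l, add_mem_sites₀ q.2.1 hl, fun h => q.2.2 (add_right_cancel h)⟩
      invFun := fun q => ⟨q - A l, sub_mem_sites₀ q.2.1 hl, fun h => q.2.2 (eq_add_of_sub_eq h)⟩
      left_inv := fun q => by ext; simp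
      right_inv := fun q => by ext; simp }
  rw [← e.tsum_eq]
  refine tsum_congr fun q => ?_
  have h1 : dist (s + A l) ((e q : {q : (EuclideanSpace ℝ (Fin 3)) // q ∈ Sites₀ t A ∧ q ≠ s + A l}) : (EuclideanSpace ℝ (Fin 3))) = dist s q := by
    show dist (s + A l) ((q : (EuclideanSpace ℝ (Fin 3))) + A l) = dist s q
    rw [dist_add_right]
  have h2 : s + A l - ((e q : {q : (EuclideanSpace ℝ (Fin 3)) // q ∈ Sites₀ t A ∧ q ≠ s + A l}) : (EuclideanSpace ℝ (Fin 3))) = s - q := by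
    show s + A l - ((q : (EuclideanSpace ℝ (Fin 3))) + A l) = s - q
    abel
  rw [h1, h2]

/-! ## The two sublattice forces are opposite: `F(t 0) + F(t 1) = 0` -/

/-- The pair force as a function of the other site, for a fixed site `s`. [folklore] -/
theorem ljPairForce_apply_neg_bond (s v : (EuclideanSpace ℝ (Fin 3))) :
    (deriv lennardJones (dist s (s - v)) / dist s (s - v)) • (s - (s - v)) =
      (deriv lennardJones ‖v‖ / ‖v‖) • v := by
  rw [dist_eq_norm, sub_sub_cancel]

/-- `−z ∈ Λ₀` for `z ∈ Λ₀`. [folklore] -/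
theorem neg_mem_Λ₀ {z : (EuclideanSpace ℝ (Fin 3))} (hz : z ∈ Λ₀) : -z ∈ Λ₀ := by
  have := hcpLiouvilleLam_sub_mem zero_mem_Λ₀ hz
  rwa [zero_sub] at this

/-- **An odd lattice sum vanishes**: `Σ'_{z ∈ Λ₀ ∖ 0} (V′(|Az|)/|Az|)·Az = 0` (pair `z` with `−z`; no
summability needed). [folklore] -/
theorem tsum_ljForce_lattice_eq_zero (A : (EuclideanSpace ℝ (Fin 3)) →L[ℝ] (EuclideanSpace ℝ (Fin 3))) :
    ∑' z : {z : (EuclideanSpace ℝ (Fin 3)) // z ∈ Λ₀ ∧ z ≠ 0}, (deriv lennardJones ‖A z‖ / ‖A z‖) • A (z : (EuclideanSpace ℝ (Fin 3))) = 0 := by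
  set T := ∑' z : {z : (EuclideanSpace ℝ (Fin 3)) // z ∈ Λ₀ ∧ z ≠ 0}, (deriv lennardJones ‖A z‖ / ‖A z‖) • A (z : (EuclideanSpace ℝ (Fin 3))) with hT
  let e : {z : (EuclideanSpace ℝ (Fin 3)) // z ∈ Λ₀ ∧ z ≠ 0} ≃ {z : (EuclideanSpace ℝ (Fin 3)) // z ∈ Λ₀ ∧ z ≠ 0} :=
    { toFun := fun z => ⟨-z, neg_mem_Λ₀ z.2.1, neg_ne_zero.2 z.2.2⟩
      invFun := fun z => ⟨-z, neg_mem_Λ₀ z.2.1, neg_ne_zero.2 z.2.2⟩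
      left_inv := fun z => by ext; simp
      right_inv := fun z => by ext; simp }
  have h : T = -T := by
    conv_lhs => rw [hT, ← e.tsum_eq]
    rw [hT, ← tsum_neg]
    refine tsum_congr fun z => ?_
    show (deriv lennardJones ‖A (-(z : (EuclideanSpace ℝ (Fin 3))))‖ / ‖A (-(z : (EuclideanSpace ℝ (Fin 3))))‖) • A (-(z : (EuclideanSpace ℝ (Fin 3)))) = _
    rw [map_neg, norm_neg, smul_neg]
  have h2 : (2 : ℝ) • T = 0 := by rw [two_smul]; nth_rewrite 2 [h]; exact add_neg_cancel T
  exact (smul_eq_zero.1 h2).resolve_left two_ne_zero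

/-- The punctured site set seen from `t 0`: nonzero vectors of sublattice `0` and all of sublattice `1`.
[folklore] -/
theorem sites_ne_eq_union_zero (hA : Adm₀ A) (hI : Inner₀ t A) :
    {q : (EuclideanSpace ℝ (Fin 3)) | q ∈ Sites₀ t A ∧ q ≠ t 0} =
      (fun z : (EuclideanSpace ℝ (Fin 3)) => t 0 + A z) '' {z : (EuclideanSpace ℝ (Fin 3)) | z ∈ Λ₀ ∧ z ≠ 0} ∪ (fun z : (EuclideanSpace ℝ (Fin 3)) => t 1 + A z) '' Λ₀ := by
  ext q
  simp only [Set.mem_setOf_eq, Set.mem_union, Set.mem_image]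
  constructor
  · rintro ⟨⟨m, z, hz, rfl⟩, hne⟩
    fin_cases m
    · refine Or.inl ⟨z, ⟨hz, ?_⟩, rfl⟩
      rintro rfl
      exact hne (by simp)
    · exact Or.inr ⟨z, hz, rfl⟩
  · rintro (⟨z, ⟨hz, hz0⟩, rfl⟩ | ⟨z, hz, rfl⟩)
    · refine ⟨⟨0, z, hz, rfl⟩, fun h => hz0 ?_⟩
      have hAz : A z = 0 := by simpa using h
      exact injective_of_adm₀ hA (by rw [hAz, map_zero])
    · refine ⟨⟨1, z, hz, rfl⟩, fun h => ?_⟩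
      have hd := dist_sites_cross_ge hA hI zero_mem_Λ₀ hz
      rw [map_zero, add_zero, h, dist_self] at hd
      norm_num at hd

/-- The punctured site set seen from `t 1`: nonzero vectors of sublattice `1` and all of sublattice `0`.
[folklore] -/
theorem sites_ne_eq_union_one (hA : Adm₀ A) (hI : Inner₀ t A) :
    {q : (EuclideanSpace ℝ (Fin 3)) | q ∈ Sites₀ t A ∧ q ≠ t 1} =
      (fun z : (EuclideanSpace ℝ (Fin 3)) => t 1 + A z) '' {z : (EuclideanSpace ℝ (Fin 3)) | z ∈ Λ₀ ∧ z ≠ 0} ∪ (fun z : (EuclideanSpace ℝ (Fin 3)) => t 0 + A z) '' Λ₀ := by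
  ext q
  simp only [Set.mem_setOf_eq, Set.mem_union, Set.mem_image]
  constructor
  · rintro ⟨⟨m, z, hz, rfl⟩, hne⟩
    fin_cases m
    · exact Or.inr ⟨z, hz, rfl⟩
    · refine Or.inl ⟨z, ⟨hz, ?_⟩, rfl⟩
      rintro rfl
      exact hne (by simp)
  · rintro (⟨z, ⟨hz, hz0⟩, rfl⟩ | ⟨z, hz, rfl⟩)
    · refine ⟨⟨1, z, hz, rfl⟩, fun h => hz0 ?_⟩
      have hAz : A z = 0 := by simpa using h
      exact injective_of_adm₀ hA (by rw [hAz, map_zero])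
    · refine ⟨⟨0, z, hz, rfl⟩, fun h => ?_⟩
      have hd := dist_sites_cross_ge hA hI hz zero_mem_Λ₀
      rw [map_zero, add_zero, ← h, dist_self] at hd
      norm_num at hd

/-- The two sublattices are disjoint (as images of the lattice). [folklore] -/
theorem disjoint_sublattice_images (hA : Adm₀ A) (hI : Inner₀ t A) (P Q : Set (EuclideanSpace ℝ (Fin 3))) (hP : P ⊆ Λ₀)
    (hQ : Q ⊆ Λ₀) :
    Disjoint ((fun z : (EuclideanSpace ℝ (Fin 3)) => t 0 + A z) '' P) ((fun z : (EuclideanSpace ℝ (Fin 3)) => t 1 + A z) '' Q) := by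
  rw [Set.disjoint_left]
  rintro q ⟨z, hz, rfl⟩ ⟨z', hz', h⟩
  have h' : t 1 + A z' = t 0 + A z := h
  have hd := dist_sites_cross_ge hA hI (hP hz) (hQ hz')
  rw [h', dist_self] at hd
  norm_num at hd

/-- **The sublattice forces are opposite**: `F(t 0) + F(t 1) = 0` for the reference forces
`F(s) = Σ'_{q ≠ s} (V′(|s−q|)/|s−q|)·(s−q)` of a perfect affine two-lattice (same-sublattice
contributions vanish by inversion symmetry `z ↦ −z`; the two cross contributions are exchanged, with a
sign, by `z ↦ −z`).  With `refForce_add` (sublattice constancy) this is Newton's third law per unit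
cell: a uniform strain produces only an OPTICAL net force, never an acoustic one. [folklore] -/
theorem refForce_zero_add_refForce_one (hA : Adm₀ A) (hI : Inner₀ t A) :
    (∑' q : {q : (EuclideanSpace ℝ (Fin 3)) // q ∈ Sites₀ t A ∧ q ≠ t 0},
        (deriv lennardJones (dist (t 0) q) / dist (t 0) q) • (t 0 - (q : (EuclideanSpace ℝ (Fin 3))))) +
      (∑' q : {q : (EuclideanSpace ℝ (Fin 3)) // q ∈ Sites₀ t A ∧ q ≠ t 1},
        (deriv lennardJones (dist (t 1) q) / dist (t 1) q) • (t 1 - (q : (EuclideanSpace ℝ (Fin 3))))) = 0 := by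
  -- notation for the summands
  set g0 : (EuclideanSpace ℝ (Fin 3)) → (EuclideanSpace ℝ (Fin 3)) := fun q => (deriv lennardJones (dist (t 0) q) / dist (t 0) q) • (t 0 - q) with hg0
  set g1 : (EuclideanSpace ℝ (Fin 3)) → (EuclideanSpace ℝ (Fin 3)) := fun q => (deriv lennardJones (dist (t 1) q) / dist (t 1) q) • (t 1 - q) with hg1
  have hinj0 : Set.InjOn (fun z : (EuclideanSpace ℝ (Fin 3)) => t 0 + A z) Set.univ :=
    fun z _ z' _ h => injective_of_adm₀ hA (add_left_cancel h)
  have hinj1 : Set.InjOn (fun z : (EuclideanSpace ℝ (Fin 3)) => t 1 + A z) Set.univ :=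
    fun z _ z' _ h => injective_of_adm₀ hA (add_left_cancel h)
  have ht0 : t 0 ∈ Sites₀ t A := ⟨0, 0, zero_mem_Λ₀, by simp⟩
  have ht1 : t 1 ∈ Sites₀ t A := ⟨1, 0, zero_mem_Λ₀, by simp⟩
  -- split F(t 0)
  have hsub0a : (fun z : (EuclideanSpace ℝ (Fin 3)) => t 0 + A z) '' {z : (EuclideanSpace ℝ (Fin 3)) | z ∈ Λ₀ ∧ z ≠ 0} ⊆ {q | q ∈ Sites₀ t A ∧ q ≠ t 0} := by
    rw [sites_ne_eq_union_zero hA hI]; exact Set.subset_union_left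
  have hsub0b : (fun z : (EuclideanSpace ℝ (Fin 3)) => t 1 + A z) '' Λ₀ ⊆ {q | q ∈ Sites₀ t A ∧ q ≠ t 0} := by
    rw [sites_ne_eq_union_zero hA hI]; exact Set.subset_union_right
  have hF0 : (∑' q : {q : (EuclideanSpace ℝ (Fin 3)) // q ∈ Sites₀ t A ∧ q ≠ t 0}, g0 q) =
      (∑' z : {z : (EuclideanSpace ℝ (Fin 3)) // z ∈ Λ₀ ∧ z ≠ 0}, g0 (t 0 + A z)) + ∑' z : Λ₀, g0 (t 1 + A z) := by
    have h1 : (∑' q : {q : (EuclideanSpace ℝ (Fin 3)) // q ∈ Sites₀ t A ∧ q ≠ t 0}, g0 q) =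
        ∑' q : ↥((fun z : (EuclideanSpace ℝ (Fin 3)) => t 0 + A z) '' {z : (EuclideanSpace ℝ (Fin 3)) | z ∈ Λ₀ ∧ z ≠ 0} ∪
          (fun z : (EuclideanSpace ℝ (Fin 3)) => t 1 + A z) '' Λ₀), g0 q := by
      rw [← sites_ne_eq_union_zero hA hI]; rfl
    rw [h1, Summable.tsum_union_disjoint (f := g0)
      (disjoint_sublattice_images hA hI _ _ (fun z hz => hz.1) subset_rfl)
      (summable_refForce_on hA hI ht0 hsub0a) (summable_refForce_on hA hI ht0 hsub0b),
      tsum_image g0 (hinj0.mono (Set.subset_univ _)), tsum_image g0 (hinj1.mono (Set.subset_univ _))]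
    rfl
  -- split F(t 1)
  have hsub1a : (fun z : (EuclideanSpace ℝ (Fin 3)) => t 1 + A z) '' {z : (EuclideanSpace ℝ (Fin 3)) | z ∈ Λ₀ ∧ z ≠ 0} ⊆ {q | q ∈ Sites₀ t A ∧ q ≠ t 1} := by
    rw [sites_ne_eq_union_one hA hI]; exact Set.subset_union_left
  have hsub1b : (fun z : (EuclideanSpace ℝ (Fin 3)) => t 0 + A z) '' Λ₀ ⊆ {q | q ∈ Sites₀ t A ∧ q ≠ t 1} := by
    rw [sites_ne_eq_union_one hA hI]; exact Set.subset_union_right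
  have hF1 : (∑' q : {q : (EuclideanSpace ℝ (Fin 3)) // q ∈ Sites₀ t A ∧ q ≠ t 1}, g1 q) =
      (∑' z : {z : (EuclideanSpace ℝ (Fin 3)) // z ∈ Λ₀ ∧ z ≠ 0}, g1 (t 1 + A z)) + ∑' z : Λ₀, g1 (t 0 + A z) := by
    have h1 : (∑' q : {q : (EuclideanSpace ℝ (Fin 3)) // q ∈ Sites₀ t A ∧ q ≠ t 1}, g1 q) =
        ∑' q : ↥((fun z : (EuclideanSpace ℝ (Fin 3)) => t 1 + A z) '' {z : (EuclideanSpace ℝ (Fin 3)) | z ∈ Λ₀ ∧ z ≠ 0} ∪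
          (fun z : (EuclideanSpace ℝ (Fin 3)) => t 0 + A z) '' Λ₀), g1 q := by
      rw [← sites_ne_eq_union_one hA hI]; rfl
    have hdisj : Disjoint ((fun z : (EuclideanSpace ℝ (Fin 3)) => t 1 + A z) '' {z : (EuclideanSpace ℝ (Fin 3)) | z ∈ Λ₀ ∧ z ≠ 0})
        ((fun z : (EuclideanSpace ℝ (Fin 3)) => t 0 + A z) '' Λ₀) :=
      (disjoint_sublattice_images hA hI _ _ subset_rfl (fun z hz => hz.1)).symm
    rw [h1, Summable.tsum_union_disjoint (f := g1) hdisj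
      (summable_refForce_on hA hI ht1 hsub1a) (summable_refForce_on hA hI ht1 hsub1b),
      tsum_image g1 (hinj1.mono (Set.subset_univ _)), tsum_image g1 (hinj0.mono (Set.subset_univ _))]
    rfl
  -- same-sublattice parts vanish
  have hS0 : (∑' z : {z : (EuclideanSpace ℝ (Fin 3)) // z ∈ Λ₀ ∧ z ≠ 0}, g0 (t 0 + A z)) = 0 := by
    have : ∀ z : {z : (EuclideanSpace ℝ (Fin 3)) // z ∈ Λ₀ ∧ z ≠ 0}, g0 (t 0 + A z) =
        -((deriv lennardJones ‖A z‖ / ‖A z‖) • A (z : (EuclideanSpace ℝ (Fin 3)))) := by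
      intro z
      simp only [hg0, dist_eq_norm, sub_add_cancel_left, norm_neg, smul_neg]
    simp only [this, tsum_neg, tsum_ljForce_lattice_eq_zero, neg_zero]
  have hS1 : (∑' z : {z : (EuclideanSpace ℝ (Fin 3)) // z ∈ Λ₀ ∧ z ≠ 0}, g1 (t 1 + A z)) = 0 := by
    have : ∀ z : {z : (EuclideanSpace ℝ (Fin 3)) // z ∈ Λ₀ ∧ z ≠ 0}, g1 (t 1 + A z) =
        -((deriv lennardJones ‖A z‖ / ‖A z‖) • A (z : (EuclideanSpace ℝ (Fin 3)))) := by
      intro z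
      simp only [hg1, dist_eq_norm, sub_add_cancel_left, norm_neg, smul_neg]
    simp only [this, tsum_neg, tsum_ljForce_lattice_eq_zero, neg_zero]
  -- cross parts are opposite
  let e : Λ₀ ≃ Λ₀ :=
    { toFun := fun z => ⟨-z, neg_mem_Λ₀ z.2⟩
      invFun := fun z => ⟨-z, neg_mem_Λ₀ z.2⟩
      left_inv := fun z => by ext; simp
      right_inv := fun z => by ext; simp }
  have hX : (∑' z : Λ₀, g1 (t 0 + A z)) = -∑' z : Λ₀, g0 (t 1 + A z) := by
    rw [← e.tsum_eq (f := fun z : Λ₀ => g1 (t 0 + A z)), ← tsum_neg]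
    refine tsum_congr fun z => ?_
    show g1 (t 0 + A (-(z : (EuclideanSpace ℝ (Fin 3))))) = -g0 (t 1 + A z)
    simp only [hg0, hg1, dist_eq_norm, map_neg]
    have hv : t 1 - (t 0 + -A (z : (EuclideanSpace ℝ (Fin 3)))) = -(t 0 - (t 1 + A z)) := by abel
    rw [hv, norm_neg, smul_neg]
  rw [hF0, hF1, hS0, hS1, hX, zero_add, zero_add, add_neg_cancel]

/-- **When is a perfect affine two-lattice itself in force balance?**  Exactly when the reference force on
one (equivalently each) sublattice vanishes: the route's `Equil` predicate for `X = Sites₀ t A` is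
equivalent to `F(t 0) = 0` (translation invariance `refForce_add` makes `F` constant on sublattices, and
`F(t 1) = −F(t 0)`). [folklore] -/
theorem sites_equil_iff (hA : Adm₀ A) (hI : Inner₀ t A) :
    (∀ p ∈ Sites₀ t A, HasSum (fun q : {q : (EuclideanSpace ℝ (Fin 3)) // q ∈ Sites₀ t A ∧ q ≠ p} =>
        (deriv lennardJones (dist p q) / dist p q) • (p - (q : (EuclideanSpace ℝ (Fin 3))))) 0) ↔
      (∑' q : {q : (EuclideanSpace ℝ (Fin 3)) // q ∈ Sites₀ t A ∧ q ≠ t 0},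
        (deriv lennardJones (dist (t 0) q) / dist (t 0) q) • (t 0 - (q : (EuclideanSpace ℝ (Fin 3))))) = 0 := by
  have ht0 : t 0 ∈ Sites₀ t A := ⟨0, 0, zero_mem_Λ₀, by simp⟩
  constructor
  · intro h
    exact (h (t 0) ht0).tsum_eq
  · intro h0 p hp
    obtain ⟨m, z, hz, rfl⟩ := hp
    have hsum := summable_refForce hA hI (s := t m + A z) ⟨m, z, hz, rfl⟩
    have hval : (∑' q : {q : (EuclideanSpace ℝ (Fin 3)) // q ∈ Sites₀ t A ∧ q ≠ t m + A z},
        (deriv lennardJones (dist (t m + A z) q) / dist (t m + A z) q) • (t m + A z - (q : (EuclideanSpace ℝ (Fin 3))))) = 0 := by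
      rw [refForce_add (t := t) (A := A) (t m) hz]
      fin_cases m
      · exact h0
      · have h01 := refForce_zero_add_refForce_one hA hI
        rw [h0, zero_add] at h01
        exact h01
    rw [← hval]
    exact hsum.hasSum

end

end Summit.AtomisticToContinuum.Crystallization.Theorems.ExcessDecayLiouville

end
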